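import Summits.ResolutionOfSingularities.ResolutionOfSingularities.Theorems.RadicialJungCleanModelsSufficeGameEndSections

/-!
# Route `RadicialJung`, crux `CleanModelsSuffice`, line `Sketch`: the END STATE of the game —
# the Kummer chart of a toroidal point is log regular at every point of its domain

Helper for the registered stub `stub_gameEndResolves` of the skeleton of
`Summit.ResolutionOfSingularities.ResolutionOfSingularities.Theses.RadicialJung.CleanModelsSuffice`
(stmt-ResolutionOfSingularities-15883). For a toroidal point `v` of an end state `S` and `w ∈ U' v`
the Kummer chart of `v` read in `A = 𝒪_{V,w}` is `kci v w : P_{aK} → integralClosure A L`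
(`kummerChartIntegral` of `…ChartsKummer` for the germs `tw_k`). This file proves:

* CASE A (`tw_k ∈ 𝔪_w` for some `k`): the vanishing germs generate the stalks at `w` of DISTINCT
  global divisors `divOf k`, hence are associated to distinct coordinates of `w`'s own regular
  system of parameters (`exists_sop_of_associated`) — the joint-regularity input of
  `isLogRegularLocal_kummerChartIntegralKN`; so `integralClosure A L` is local and `kci v w` is log
  regular (`caseA`);
* CASE B (no `tw_k ∈ 𝔪_w`): every chart value is a unit, and `w` is NOT toroidal (a charged divisor
  at `w` would be one of the `divOf k`, by the good neighbourhood), so `V^L` is regular over `w`;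
* at EVERY point `w` the ring `integralClosure 𝒪_{V,w} L` is local (Case A of `w`'s own chart, or
  regular), so the stalks of `V^L` are these integral closures compatibly with values in `L`
  (`exists_stalkIso`), and **the Kummer chart `kφ v` is log regular at every point of
  `ι⁻¹ (U' v)`** (`isLogRegularLocal_kφ`).
-/

noncomputable section

set_option linter.dupNamespace false -- mandated namespace of this single-conjunct summit

open CategoryTheory AlgebraicGeometry TopologicalSpace IsLocalRing
open Literature.AlgebraicGeometry.Resolution

namespace Summit.ResolutionOfSingularities.ResolutionOfSingularities.Theorems.RadicialJung.CleanModelsSuffice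

attribute [local instance] stalkAlgebra isScalarTower_stalkAlgebra

/-! ## Joint regularity from associated coordinates -/

/-- **Elements associated to distinct members of a regular system of parameters are jointly part
of a minimal system of generators of `𝔪`** (in the shape consumed by
`isLogRegularLocal_kummerChartIntegralKN`): replace the matched coordinates by the given elements.
[folklore] -/
theorem exists_sop_of_associated {A : Type*} [CommRing A] [IsRegularLocalRing A] {d : ℕ}
    (u : Fin d → A) (hu : Ideal.span (Set.range u) = maximalIdeal A)
    (hd : (maximalIdeal A).spanFinrank = d) {m : ℕ} (t : Fin m → A) (j : Fin m → Fin d)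
    (hassoc : ∀ k, t k ∈ maximalIdeal A → Associated (t k) (u (j k)))
    (hinj : ∀ k k', t k ∈ maximalIdeal A → t k' ∈ maximalIdeal A → j k = j k' → k = k') :
    ∃ (dw : ℕ) (tw : Fin dw → A) (ι : Fin m → Fin dw),
      Ideal.span (Set.range tw) = maximalIdeal A ∧ ringKrullDim A = (dw : WithBot ℕ∞) ∧
      (∀ k, t k ∈ maximalIdeal A → tw (ι k) = t k) ∧
      (∀ k k', t k ∈ maximalIdeal A → t k' ∈ maximalIdeal A → ι k = ι k' → k = k') := by
  classical
  let tw : Fin d → A := fun i =>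
    if h : ∃ k, t k ∈ maximalIdeal A ∧ j k = i then t h.choose else u i
  have htw : ∀ i, Associated (tw i) (u i) := by
    intro i
    by_cases h : ∃ k, t k ∈ maximalIdeal A ∧ j k = i
    · simp only [tw, dif_pos h]
      have h1 := h.choose_spec
      have h2 : u (j h.choose) = u i := by rw [h1.2]
      rw [← h2]
      exact hassoc _ h1.1
    · simp only [tw, dif_neg h]
      exact Associated.refl _
  refine ⟨d, tw, j, ?_, ?_, ?_, hinj⟩
  · rw [Ideal.span_range_eq_of_associated htw, hu]
  · have h := IsRegularLocalRing.spanFinrank_maximalIdeal (R := A)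
    rw [hd] at h
    exact h.symm
  · intro k hk
    have h : ∃ k', t k' ∈ maximalIdeal A ∧ j k' = j k := ⟨k, hk, rfl⟩
    simp only [tw, dif_pos h]
    have h1 := h.choose_spec
    rw [hinj _ _ h1.1 hk h1.2]

namespace GameState

variable {p : ℕ} {V₀ : Scheme.{0}} [IsIntegral V₀] {L : Type} [Field L] [Algebra V₀.functionField L]
  {V : Scheme.{0}} [IsIntegral V] {π : V ⟶ V₀} [IsDominant π] (S : GameState p V₀ L V π)
  [Algebra V.functionField L]

/-! ## The Kummer chart of `v` read in `𝒪_{V,w}` -/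

/-- **The Kummer chart of `v` at `w ∈ U' v`**: `P_{aK} → integralClosure 𝒪_{V,w} L`. [folklore] -/
def kci (S : GameState p V₀ L V π) (H : S.EndHyp) {v : V} (hv : v ∈ S.tor) (w : V) (hw : w ∈ S.U' H hv) :
    Multiplicative (kummerMonoid p (S.aK H hv)) →* integralClosure (V.presheaf.stalk w) L :=
  kummerChartIntegral p (S.aK H hv) (S.yN H hv) (S.tw H hv w hw) H.prime.pos (S.yN_ne_zero H hv)
    (S.algebraMap_tw_ne_zero H hv w hw) (S.yN_pow_tw H hv w hw)

/-- The values of `kci` in `L` are the values of `kΦ`. [folklore] -/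
theorem coe_kci (H : S.EndHyp) {v : V} (hv : v ∈ S.tor) (w : V) (hw : w ∈ S.U' H hv)
    (c : Multiplicative (kummerMonoid p (S.aK H hv))) : (S.kci H hv w hw c : L) = S.kΦ H hv c := by
  have hu : (fun k => algebraMap (V.presheaf.stalk w) L (S.tw H hv w hw k)) = S.uC H hv :=
    funext fun k => (S.uC_eq_algebraMap_tw H hv w hw k).symm
  rw [kci, coe_kummerChartIntegral, kΦ, kummerChart_apply, kummerChart_apply, hu]

/-- The `p`-th power of a value of `kci` is the weight monomial `∏ tw_k^{w_k(c)}`. [folklore] -/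
theorem coe_kci_pow (H : S.EndHyp) {v : V} (hv : v ∈ S.tor) (w : V) (hw : w ∈ S.U' H hv)
    (c : Multiplicative (kummerMonoid p (S.aK H hv))) :
    (S.kci H hv w hw c : L) ^ p = algebraMap (V.presheaf.stalk w) L
      (∏ k, S.tw H hv w hw k ^ (kummerWeight p (S.aK H hv)
        ((Multiplicative.toAdd c : kummerMonoid p (S.aK H hv)) : Fin (S.nC v + 1) → ℤ) k).toNat) := by
  rw [kci, coe_kummerChartIntegral, kummerChart_apply]
  exact kummerChartFun_pow_eq_algebraMap p _ _ _ (S.algebraMap_tw_ne_zero H hv w hw)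
    (S.yN_pow_tw H hv w hw) (Multiplicative.toAdd c).2

/-! ## Case A: joint regularity of the vanishing germs -/

/-- A vanishing germ `tw_k ∈ 𝔪_w` is associated to the label coordinate of `divOf k` at `w`.
[folklore] -/
theorem associated_tw_lab (H : S.EndHyp) {v : V} (hv : v ∈ S.tor) (w : V) (hw : w ∈ S.U' H hv)
    (k : Fin (S.nC v + 1)) (hk : S.tw H hv w hw k ∈ maximalIdeal (V.presheaf.stalk w)) :
    Associated (S.tw H hv w hw k) (S.u w (S.lab w ⟨(S.divOf H.endCond hv k).1,
      (S.divOf H.endCond hv k).2.1, (S.mem_support_divOf_iff H hv w hw k).mpr hk⟩)) := by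
  rw [← Ideal.span_singleton_eq_span_singleton, ← S.stalkIdeal_divOf_eq_span_tw H hv w hw k]
  exact S.stalkIdeal_lab w ⟨(S.divOf H.endCond hv k).1, (S.divOf H.endCond hv k).2.1,
    (S.mem_support_divOf_iff H hv w hw k).mpr hk⟩

/-- **Case A at a point**: if some boundary section of the chart of `v` vanishes at `w ∈ U' v`,
then `integralClosure 𝒪_{V,w} L` is local and the Kummer chart of `v` into it is log regular.
[folklore] -/
theorem caseA (H : S.EndHyp) {v : V} (hv : v ∈ S.tor) (w : V) (hw : w ∈ S.U' H hv)
    (hA : ∃ k, S.tw H hv w hw k ∈ maximalIdeal (V.presheaf.stalk w)) :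
    IsLocalRing (integralClosure (V.presheaf.stalk w) L) ∧
      LogChart.IsLogRegularLocal (kummerMonoid p (S.aK H hv)) (S.kci H hv w hw) := by
  classical
  haveI := S.isRegular w
  haveI := H.charP
  obtain ⟨k₀, hk₀⟩ := hA
  -- the matched coordinates of `w`
  let j : Fin (S.nC v + 1) → Fin (S.d w) := fun k =>
    if hk : S.tw H hv w hw k ∈ maximalIdeal (V.presheaf.stalk w) then
      S.lab w ⟨(S.divOf H.endCond hv k).1, (S.divOf H.endCond hv k).2.1,
        (S.mem_support_divOf_iff H hv w hw k).mpr hk⟩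
    else S.lab w ⟨(S.divOf H.endCond hv k₀).1, (S.divOf H.endCond hv k₀).2.1,
        (S.mem_support_divOf_iff H hv w hw k₀).mpr hk₀⟩
  have hassoc : ∀ k, S.tw H hv w hw k ∈ maximalIdeal (V.presheaf.stalk w) →
      Associated (S.tw H hv w hw k) (S.u w (j k)) := by
    intro k hk
    simp only [j, dif_pos hk]
    exact S.associated_tw_lab H hv w hw k hk
  have hinj : ∀ k k', S.tw H hv w hw k ∈ maximalIdeal (V.presheaf.stalk w) →
      S.tw H hv w hw k' ∈ maximalIdeal (V.presheaf.stalk w) → j k = j k' → k = k' := by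
    intro k k' hk hk' h
    simp only [j, dif_pos hk, dif_pos hk'] at h
    have h1 := S.lab_injective w h
    have h2 := congrArg Subtype.val h1
    exact S.divOf_injective H.endCond hv (Subtype.ext h2)
  have hsop := exists_sop_of_associated (S.u w) (S.span_u w) (S.spanFinrank_eq w) (S.tw H hv w hw) j
    hassoc hinj
  exact isLogRegularLocal_kummerChartIntegralKN p H.prime H.finrank (S.nC v) (S.tw H hv w hw)
    (S.tw_ne_zero H hv w hw) (S.algebraMap_tw_ne_zero H hv w hw) (S.aK H hv) (S.aK_zero H hv)
    (S.aK_bounds H hv) (S.yN H hv) (S.yN_not_mem H hv) (S.yN_ne_zero H hv) (S.yN_pow_tw H hv w hw)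
    ⟨k₀, hk₀⟩ hsop

/-! ## Case B: units, and `w` is not toroidal -/

/-- **Case B: all chart values are units** if no boundary section of `v` vanishes at `w`.
[folklore] -/
theorem isUnit_kci (H : S.EndHyp) {v : V} (hv : v ∈ S.tor) (w : V) (hw : w ∈ S.U' H hv)
    (hB : ∀ k, S.tw H hv w hw k ∉ maximalIdeal (V.presheaf.stalk w))
    (c : Multiplicative (kummerMonoid p (S.aK H hv))) : IsUnit (S.kci H hv w hw c) := by
  refine isUnit_of_pow_eq_algebraMap p H.prime.pos _ _ ?_ (S.coe_kci_pow H hv w hw c)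
  refine Finset.prod_induction _ IsUnit (fun _ _ => IsUnit.mul) isUnit_one fun k _ => ?_
  exact (IsLocalRing.notMem_maximalIdeal.mp (hB k)).pow _

/-- **Case B points are not toroidal**: a charged divisor at `w ∈ U' v` is charged at `v` (good
neighbourhood), hence one of the `divOf k`, whose section then vanishes at `w`. [folklore] -/
theorem not_mem_tor_of_forall_not_mem (H : S.EndHyp) {v : V} (hv : v ∈ S.tor) (w : V)
    (hw : w ∈ S.U' H hv) (hB : ∀ k, S.tw H hv w hw k ∉ maximalIdeal (V.presheaf.stalk w)) :
    w ∉ S.tor := by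
  rintro ⟨D, hD⟩
  obtain ⟨hwD, hDv⟩ := ((S.near_of_mem_U' H hv hw).chargedAt_iff S H D).mp hD
  obtain ⟨k, hk⟩ := S.exists_divOf_eq H.endCond hv hDv
  refine hB k ((S.mem_support_divOf_iff H hv w hw k).mp ?_)
  rw [hk]
  exact hwD

/-! ## The local rings of `V^L` -/

/-- **`integralClosure 𝒪_{V,w} L` is a local ring at every point `w`** (Case A of `w`'s own chart
at a toroidal `w`; a regular local ring otherwise). [folklore] -/
theorem isLocalRing_integralClosure (H : S.EndHyp) (w : V) :
    IsLocalRing (integralClosure (V.presheaf.stalk w) L) := by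
  by_cases hw : w ∈ S.tor
  · refine (S.caseA H hw w (S.mem_U' H hw) ⟨0, ?_⟩).1
    rw [S.tw_self H hw 0]
    exact S.b_mem H hw 0
  · haveI := S.isRegularLocalRing_integralClosure_of_not_mem_tor H hw
    infer_instance

/-- **The stalks of `V^L` over non-toroidal points are regular.** [folklore] -/
theorem isRegularLocalRing_stalk_of_not_mem_tor (H : S.EndHyp) (x : normalizationIn V L)
    (hx : normalizationInι V L x ∉ S.tor) :
    IsRegularLocalRing ((normalizationIn V L).presheaf.stalk x) := by
  haveI := S.isRegularLocalRing_integralClosure_of_not_mem_tor H hx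
  exact CleanResolves.isRegularLocalRing_stalk_normalizationIn V L x

/-- **The stalk isomorphism** `𝒪_{V^L,x} ≃ integralClosure 𝒪_{V,ιx} L` compatible with values in
`L`. [folklore] -/
theorem exists_stalkIso (H : S.EndHyp) (x : normalizationIn V L) :
    ∃ e : (normalizationIn V L).presheaf.stalk x ≃+*
        integralClosure (V.presheaf.stalk (normalizationInι V L x)) L,
      ∀ z, ((e z : integralClosure (V.presheaf.stalk (normalizationInι V L x)) L) : L) =
        stalkToField V L x z := by
  haveI := S.isLocalRing_integralClosure H (normalizationInι V L x)
  exact exists_ringEquiv_stalk_integralClosure V L x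

/-- **Through the stalk isomorphism the germ of `kφ v c` is `kci v (ι x) c`.** [folklore] -/
theorem stalkIso_germ_kφ (H : S.EndHyp) {v : V} (hv : v ∈ S.tor) (x : normalizationIn V L)
    (hx : x ∈ normalizationInι V L ⁻¹ᵁ S.U' H hv)
    (e : (normalizationIn V L).presheaf.stalk x ≃+*
      integralClosure (V.presheaf.stalk (normalizationInι V L x)) L)
    (he : ∀ z, ((e z : integralClosure (V.presheaf.stalk (normalizationInι V L x)) L) : L) =
      stalkToField V L x z)
    (c : Multiplicative (kummerMonoid p (S.aK H hv))) :
    e ((normalizationIn V L).presheaf.germ (normalizationInι V L ⁻¹ᵁ S.U' H hv) x hx (S.kφ H hv c)) =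
      S.kci H hv (normalizationInι V L x) hx c := by
  apply Subtype.ext
  rw [he, S.stalkToField_germ_kφ, S.coe_kci]

/-- **The Kummer chart of a toroidal point is log regular at every point of its domain** (Case A:
transport along the stalk isomorphism; Case B: units and a regular stalk). [folklore] -/
theorem isLogRegularLocal_kφ (H : S.EndHyp) {v : V} (hv : v ∈ S.tor) (x : normalizationIn V L)
    (hx : x ∈ normalizationInι V L ⁻¹ᵁ S.U' H hv) :
    LogChart.IsLogRegularLocal (kummerMonoid p (S.aK H hv))
      (((normalizationIn V L).presheaf.germ (normalizationInι V L ⁻¹ᵁ S.U' H hv) x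
        hx).hom.toMonoidHom.comp (S.kφ H hv)) := by
  obtain ⟨e, he⟩ := S.exists_stalkIso H x
  have hcomp : e.toMonoidHom.comp (((normalizationIn V L).presheaf.germ
      (normalizationInι V L ⁻¹ᵁ S.U' H hv) x hx).hom.toMonoidHom.comp (S.kφ H hv)) =
      S.kci H hv (normalizationInι V L x) hx :=
    MonoidHom.ext fun c => S.stalkIso_germ_kφ H hv x hx e he c
  by_cases hA : ∃ k, S.tw H hv (normalizationInι V L x) hx k ∈
      maximalIdeal (V.presheaf.stalk (normalizationInι V L x))
  · have h := (S.caseA H hv _ hx hA).2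
    rw [← hcomp] at h
    exact (LogChart.isLogRegularLocal_comp_equiv _ _ e).mp h
  · push Not at hA
    have hunit : ∀ c : kummerMonoid p (S.aK H hv),
        IsUnit ((((normalizationIn V L).presheaf.germ (normalizationInι V L ⁻¹ᵁ S.U' H hv) x
          hx).hom.toMonoidHom.comp (S.kφ H hv)) (Multiplicative.ofAdd c)) := by
      intro c
      have h1 := S.isUnit_kci H hv _ hx hA (Multiplicative.ofAdd c)
      rw [← S.stalkIso_germ_kφ H hv x hx e he] at h1
      exact (isUnit_map_iff e _).mp h1
    rw [LogChart.isLogRegularLocal_iff_of_forall_isUnit _ (span_kummerMonoid_eq_top p _) _ hunit]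
    exact S.isRegularLocalRing_stalk_of_not_mem_tor H x (S.not_mem_tor_of_forall_not_mem H hv _ hx hA)

end GameState

/-- The integral closures of the local rings of the base of an end state in `L` are local
(explicit-binder form, the registered interface of this helper file). [folklore] -/
theorem gameState_isLocalRing_integralClosure {p : ℕ} {V₀ : Scheme.{0}} [IsIntegral V₀] {L : Type}
    [Field L] [Algebra V₀.functionField L] {V : Scheme.{0}} [IsIntegral V] {π : V ⟶ V₀} [IsDominant π]
    (S : GameState p V₀ L V π) [Algebra V.functionField L] (H : S.EndHyp) (w : V) :
    IsLocalRing (integralClosure (V.presheaf.stalk w) L) :=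
  S.isLocalRing_integralClosure H w

end Summit.ResolutionOfSingularities.ResolutionOfSingularities.Theorems.RadicialJung.CleanModelsSuffice

end
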